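/-
# Row X-8″: `RH ⟺ MaxRe ∧ LPSD(h)` — the kernel upgrade of the §17 splitting

(rh-split cell, seat rh-split-screw-bridge g13, 2026-08-27; kernel scratch for card
`cards/SPLIT-screw-bridge.md` §18.)  Nothing in this file is a claim about the truth of RH.
Depends on `ScrewLatticeSupB2` (tree, p544349) and `ScrewLatticePSD` (this generation, pending).
-/
import Summits.RiemannHypothesis.RiemannHypothesis.Theorems.Splittings.ScrewLatticeSupB2
import Summits.RiemannHypothesis.RiemannHypothesis.Theorems.Splittings.ScrewLatticePSD
import HarnessLib

/-!
# Row X-8″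

`(∃ ρ₀ ∈ 𝒩, ∀ ρ ∈ 𝒩, Re ρ ≤ Re ρ₀) ∧ LPSD(h) ⟺ RH` for every `h > 0`, where
`LPSD(h)` = non-negativity of the Kreĭn–Suzuki forms `Σᵢⱼ (Ψ(tᵢ) + Ψ(tⱼ) - Ψ(tᵢ - tⱼ)) xᵢ xⱼ` on lattice
configurations `tᵢ ∈ h ℕ`.  `⟸`: RH gives MaxRe (Hardy, `maxRe_of_rh`) and `LPSD(h)` (Suzuki Thm 1.2,
`latticeForm_nonneg_of_rh`); `⟹`: `LPSD(h) ⟹ LAT(h)` (diagonal, `latticePos_of_latticePSD`) and X-8′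
(`maxRe_and_latticePos_iff_rh`).  The `B`-conjunct `LPSD(h)` is two-sided (`0 ≤ Ψ(k h) ≤ k² Ψ(h)`,
`zetaScrew_lattice_le_sq_mul`) and is passed by the Wolff-packing configuration of the zero-side model
class (`ScrewLatticeWolff.modelPsi_latticePSD`), which has no zero-free strip: barrier candidate B16.

Hygiene: no `sorry`, no new axioms, no instances, no notation, nothing `private`.
-/

set_option linter.dupNamespace false

noncomputable section

open Complex Filter Topology Finset

namespace Summit.RiemannHypothesis.RiemannHypothesis.Theorems.Splittings.ScrewLatticePSD

open Literature.NumberTheory.LFunctions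
open Literature.Analysis.Complex (IsPosSemidefKernelOn)
open Summit.RiemannHypothesis.RiemannHypothesis.Theorems.Splittings.ScrewLatticeSup

/-- **ROW X-8″ (the splitting, kernel form of `B`)**: for every `h > 0`,
`(MaxRe) ∧ (LPSD(h)) ↔ RiemannHypothesis`. -/
theorem maxRe_and_latticePSD_iff_rh {h : ℝ} (hh : 0 < h) :
    ((∃ ρ₀ : ℂ, ρ₀ ∈ ZetaZeros.riemannZetaNontrivialZeros ∧
        ∀ ρ : ℂ, ρ ∈ ZetaZeros.riemannZetaNontrivialZeros → ρ.re ≤ ρ₀.re) ∧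
      ∀ (N : ℕ) (t x : Fin N → ℝ), (∀ i, t i ∈ Set.range fun k : ℕ ↦ (k : ℝ) * h) →
        0 ≤ ∑ i, ∑ j, zetaScrewKernel (t i) (t j) * (x i * x j)) ↔ RiemannHypothesis := by
  constructor
  · rintro ⟨hmax, hpsd⟩
    exact (maxRe_and_latticePos_iff_rh hh).1 ⟨hmax, latticePos_of_latticePSD hpsd⟩
  · exact fun hRH ↦ ⟨maxRe_of_rh hRH, latticeForm_nonneg_of_rh hRH h⟩

/-- The same with `B` in `IsPosSemidefKernelOn` form (complex coefficients). -/
theorem maxRe_and_isPosSemidefKernelOn_lattice_iff_rh {h : ℝ} (hh : 0 < h) :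
    ((∃ ρ₀ : ℂ, ρ₀ ∈ ZetaZeros.riemannZetaNontrivialZeros ∧
        ∀ ρ : ℂ, ρ ∈ ZetaZeros.riemannZetaNontrivialZeros → ρ.re ≤ ρ₀.re) ∧
      IsPosSemidefKernelOn (fun t u : ℝ ↦ (zetaScrewKernel t u : ℂ))
        (Set.range fun k : ℕ ↦ (k : ℝ) * h)) ↔ RiemannHypothesis := by
  rw [isPosSemidefKernelOn_zetaScrewKernel_iff]
  exact maxRe_and_latticePSD_iff_rh hh

/-- **Graded reading of X-8″, `B`-side unconditional:** `LPSD(h)` alone already pins the lattice values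
into `0 ≤ Ψ(k h) ≤ k² Ψ(h)`; with MaxRe it is RH. -/
theorem latticePSD_consequences {h : ℝ} (hh : 0 < h)
    (hpsd : ∀ (N : ℕ) (t x : Fin N → ℝ), (∀ i, t i ∈ Set.range fun k : ℕ ↦ (k : ℝ) * h) →
      0 ≤ ∑ i, ∑ j, zetaScrewKernel (t i) (t j) * (x i * x j)) :
    (∀ k : ℕ, 0 ≤ zetaScrew (k * h) ∧ zetaScrew (k * h) ≤ (k : ℝ) ^ 2 * zetaScrew h) ∧
      ((∃ ρ₀ : ℂ, ρ₀ ∈ ZetaZeros.riemannZetaNontrivialZeros ∧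
        ∀ ρ : ℂ, ρ ∈ ZetaZeros.riemannZetaNontrivialZeros → ρ.re ≤ ρ₀.re) → RiemannHypothesis) :=
  ⟨zetaScrew_lattice_le_sq_mul hpsd, fun hmax ↦ (maxRe_and_latticePSD_iff_rh hh).1 ⟨hmax, hpsd⟩⟩

end Summit.RiemannHypothesis.RiemannHypothesis.Theorems.Splittings.ScrewLatticePSD

end
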